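import Mathlib
import Literature.Computability.AlgebraicComplexity.NewtonPolygonTauSumsOfPowers
import HarnessLib

/-!
# KPTT 2015, Theorems 1 and 3 AS PRINTED: the refined transfer with exponent `c < 2`

P. Koiran, N. Portier, S. Tavenas, S. Thomassé, *A τ-conjecture for Newton polygons*, Found.
Comput. Math. 15 (2015) 185–197 (arXiv:1308.2286), §2 Theorem 1 (held text p0004:L103–L113) and
§3 "Proof of Theorem 1, and a Refinement" (proof p0005:L1–L82, Theorem 3 p0005:L92–L102).

Printed statements.

* **Theorem 1.** "Assume that for some universal constant `c < 2`, the upper bound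
  `2^{(m + log kt)^c}` on the number of edges of `Newt(f)` holds true for polynomials of the form (1)
  [`f = Σ_{i=1}^k Π_{j=1}^m f_ij`, the `f_ij` with at most `t` monomials] whenever the product `kmt`
  is sufficiently large. Then the permanent is not computable by polynomial size arithmetic
  circuits. — For instance, an upper bound of the form `2^{O(m)}(kt)^{O(1)}` would be sufficient."
* **Theorem 3.** "Fix a universal constant `c < 2`, and assume that we have the upper bound
  `2^{(m + log kt)^c}` on the number of edges of `Newt(f)` for polynomials of the form
  `f(X,Y) = Σ_{i=1}^k a_i f_i(X,Y)^m` where `a_i ∈ 𝕂` and the `f_i` have at most `t` monomials (as in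
  Theorem 1, we require this upper bound to hold only if `kmt` is sufficiently large). Then the
  permanent is not computable by polynomial size arithmetic circuits." Followed by: "Clearly, we
  can assume that all the coefficients `a_i` are equal to 1".

What the tree had. `KPTT.theorem1` / `KPTT.theorem1_holds` (`NewtonPolygonTau.lean`,
`NewtonPolygonTauTransfer.lean`) record Theorem 1 in the WEAK-FORM INSTANCE (hypothesis
`newtonTauWeak` = the "for instance" bound `2^{am}(kt+2)^b`), and `NewtonPolygonTauSumsOfPowers.lean`
records Theorem 3 in the same instance, with the module note `-- TODO(general form)`; the module
docstring of `NewtonPolygonTau.lean` lists "Thms 2–3 (the refined transfer with exponent `c < 2`)"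
as not recorded. This file records BOTH THEOREMS AS PRINTED, as theorems of the tree (no named
fact, no definition): the printed hypothesis is an explicit binder — `(c : ℝ) (hc : c < 2) (N₀ : ℕ)`
and the bound for all `k m t` with `N₀ ≤ kmt` — and is NEVER ASSERTED (like `newtonTauWeak`, it is an
open statement; nothing here bears on `VP ≠ VNP`).

Conventions made explicit (read by referees).
* "number of edges of `Newt(f)`" = the tree's `newtonVertexCount f` (number of vertices; equal to
  the number of edges for a genuine polygon — `NewtonPolygonTau.lean`, module docstring).
* "`log`" = `log₂` (`Real.logb 2`), the reading under which the "for instance" bound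
  `2^{O(m)}(kt)^{O(1)} = 2^{O(m) + O(log kt)}` is an instance (`refinedBound_of_newtonTauWeak` below
  makes that sentence a theorem: the weak bound implies the printed hypothesis with `c = 3/2`).
  The power `(m + log kt)^c` is the real power `Real.rpow` (base `≥ 0` whenever `kt ≥ 1`).
* "whenever the product `kmt` is sufficiently large" = `∃ N₀, ∀ k m t, N₀ ≤ kmt → …`, with `N₀` a
  binder of the theorems.
* "the permanent is not computable by polynomial size arithmetic circuits" (over a field of
  characteristic `0`; Remark 1: `≠ 2`) = `¬ IsVPFamily (fun n => perPoly (Fin n) ℂ)` over `ℂ`, exactly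
  as in `KPTT.theorem1`.

Proof (the printed §3, followed step by step on the tree's Step 1–3 lemmas of
`NewtonPolygonTauTransfer.lean`; only Step 4 changes). Assuming `PER ∈ VP_ℂ`, the witness
`F_n = Σ_{i<2ⁿ} XⁱY^{2i(2ⁿ-1-i)}` (`kpttPoly`, `2ⁿ` vertices, `newtonVertexCount_kpttPoly`) is written
as `Σ_{i≤k} Π_{j≤m} g_ij` with `k, t ≤ (n+2)^{C(⌊√(2n+3)⌋+1)}`, `m ≤ C(⌊√(2n+3)⌋+1)`
(`exists_sps_xy_of_isProjection_perPoly`: depth-four reduction + the substitution (plugin)), i.e.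
"`k = n^{O(√n log n)}`, `t = n^{O(√n log n)}` and `m = O(√n)`" (p0005:L8–L9). Hence
`m + log₂ kt = O(√n · log n)` and the printed hypothesis gives `2ⁿ ≤ 2^{(D√n·log n)^c}`, i.e.
`n ≤ (D√n log n)^c`, which fails for large `n` BECAUSE `c < 2` ("here, we use the fact that the
constant `c` … is smaller than 2", p0005:L15–L16): `(log n)^c = o(n^{1-c/2})` (Mathlib
`isLittleO_log_rpow_rpow_atTop`). Two bookkeeping points not in print: (i) to meet "`kmt`
sufficiently large" we pad the representation with `N₀` zero products (`Fin.append g 0`), which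
changes `k` into `k + N₀`; (ii) the proof only ever uses the hypothesis with `k, m, t ≥ 1`, and the
exponent `c` may be raised to `max c 1` there (base `≥ 1`), so no sign condition on `c` is needed.
Theorem 3 ⇒ Theorem 1: Fischer's formula (`KPTT.sum_prod_eq_sum_powers`, the tree's Ryser form with
`2^m` powers) turns form (1) with parameters `(k, m, t)` into a sum of `k·2^m` `m`-th powers of
`mt`-sparse polynomials, and `m + log₂(k 2^m · mt) ≤ 3(m + log₂ kt)`; the printed sentence "the
assumption in Theorem 3 implies that of Theorem 1" is thus true UP TO THE CONSTANT FACTOR `3`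
INSIDE THE POWER, which the proof of Theorem 1 absorbs — we therefore prove the common core
`not_isVPFamily_per_of_refinedBound_mul` (Theorem 1's proof for the bound
`2^{(A(m + log₂ kt))^c}`, any `A ≥ 1`) and derive both theorems from it.

Contents (all theorems, 0 definitions, 0 named facts):
* `KPTT.card_support_kpttPoly` — `F_n` has exactly `2ⁿ` monomials;
* `KPTT.not_isVPFamily_per_of_refinedBound_mul` — the core (Theorem 1 with a factor `A ≥ 1`);
* `KPTT.not_isVPFamily_per_of_refinedBound` — **Theorem 1 as printed**;
* `KPTT.refinedBound_of_newtonTauWeak` — "For instance, an upper bound of the form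
  `2^{O(m)}(kt)^{O(1)}` would be sufficient": the weak bound implies the printed hypothesis
  (`c = 3/2`), so the tree's `KPTT.theorem1` (landed as `theorem1_holds`, not restated) is a
  corollary of the printed theorem;
* `KPTT.not_isVPFamily_per_of_refinedPowersBound` — **Theorem 3 as printed** (coefficients `a_i`), and
  `KPTT.not_isVPFamily_per_of_refinedPurePowersBound` — the same from the coefficient-free hypothesis ("we can assume that
  all the coefficients `a_i` are equal to 1").

Vacuity pass on the inlined hypothesis (typed-vs-printed audit, done by the typer). (a) Degenerate
parameters: Mathlib's `Real.logb 2 0 = 0`, so at `kt = 0` the bound reads `2^{m^c} ≥ 1`, which the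
only polynomials of form (1) with `t = 0` or `k = 0` (the zero polynomial, or a constant when `m = 0`)
satisfy — no units slip makes the hypothesis trivially unsatisfiable; the proofs below use it only
at `k, m, t ≥ 1`. (b) At `c = 3/2` (and a suitable `N₀`) the hypothesis is IMPLIED by the (stronger)
weak-form bound `newtonTauWeak` (`refinedBound_of_newtonTauWeak`), so at that exponent it is
refutable only if `newtonTauWeak` is. (c) It is genuinely refutable at small `kmt` (that is what `N₀`
is for) and, for `c < 1`, at all `kmt` (one `t`-sparse polynomial, `k = m = 1`, may have `t` hull
vertices while `2^{(1 + log₂ t)^c} < t` for large `t`): the live range of the printed "universal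
constant `c < 2`" is `1 ≤ c < 2` (the theorems below hold for every real `c < 2` regardless).

Honest framing (val-lit): kernel proofs of two published CONDITIONAL theorems; their hypotheses
(refined Newton-polygon τ-bounds) are OPEN and are not asserted anywhere in the tree; `VP ≠ VNP` is
NOT proved and nothing here is progress on it.

## References

* P. Koiran, N. Portier, S. Tavenas, S. Thomassé, Found. Comput. Math. 15 (2015) 185–197,
  arXiv:1308.2286: Theorem 1 and the sentence following it (§2), §3 (proof of Theorem 1, Theorem 3,
  Lemma 1 and the proof of Theorem 3) [KoiranPortierTavenasThomasse2015].
-/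

noncomputable section

open Finset MvPolynomial Filter

namespace Literature.Computability.AlgebraicComplexity

namespace KPTT

open TavenasVn

/-! ### The witness has `2ⁿ` monomials -/

/-- `F_n = Σ_{i<2ⁿ} XⁱY^{2i(2ⁿ-1-i)}` has exactly `2ⁿ` monomials (its exponent vectors are pairwise
distinct). [cite: KoiranPortierTavenasThomasse2015, §3 (hardpoly), variant of the tree] -/
theorem card_support_kpttPoly (n : ℕ) : (kpttPoly n).support.card = 2 ^ n := by
  rw [support_kpttPoly, Finset.card_image_of_injective _ (kpttExp_injective n), Finset.card_range]

/-! ### Step 4 of the printed proof: the growth comparison (where `c < 2` is used) -/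

/-- For `c < 2` and `D ≥ 0`: `(D · √x · log x)^c < x` for all large real `x`
(`(log x)^c = o(x^{1 - c/2})`). [folklore] -/
private theorem eventually_mul_sqrt_mul_log_rpow_lt {c : ℝ} (hc : c < 2) {D : ℝ}
    (hD : 0 ≤ D) : ∀ᶠ x : ℝ in atTop, (D * Real.sqrt x * Real.log x) ^ c < x := by
  have hδ : 0 < 1 - c / 2 := by linarith
  have hDc : 0 ≤ D ^ c := Real.rpow_nonneg hD c
  have hε : 0 < 1 / (D ^ c + 1) := by positivity
  filter_upwards [(isLittleO_log_rpow_rpow_atTop c hδ).def hε, eventually_ge_atTop (1 : ℝ)]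
    with x hx hx1
  have hx0 : 0 < x := by linarith
  have hlog : 0 ≤ Real.log x := Real.log_nonneg hx1
  rw [Real.norm_of_nonneg (Real.rpow_nonneg hlog c),
    Real.norm_of_nonneg (Real.rpow_nonneg hx0.le _)] at hx
  have hsqrt : Real.sqrt x ^ c = x ^ (c / 2) := by
    rw [Real.sqrt_eq_rpow, ← Real.rpow_mul hx0.le]
    congr 1
    ring
  rw [Real.mul_rpow (mul_nonneg hD (Real.sqrt_nonneg x)) hlog,
    Real.mul_rpow hD (Real.sqrt_nonneg x), hsqrt]
  have hxδ : 0 < x ^ (1 - c / 2) := Real.rpow_pos_of_pos hx0 _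
  have h1 : D ^ c * Real.log x ^ c < x ^ (1 - c / 2) := by
    calc D ^ c * Real.log x ^ c ≤ D ^ c * (1 / (D ^ c + 1) * x ^ (1 - c / 2)) :=
          mul_le_mul_of_nonneg_left hx hDc
      _ = (D ^ c / (D ^ c + 1)) * x ^ (1 - c / 2) := by ring
      _ < 1 * x ^ (1 - c / 2) := by
          refine mul_lt_mul_of_pos_right ?_ hxδ
          rw [div_lt_one (by positivity)]
          linarith
      _ = x ^ (1 - c / 2) := one_mul _
  calc D ^ c * x ^ (c / 2) * Real.log x ^ c = x ^ (c / 2) * (D ^ c * Real.log x ^ c) := by ring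
    _ < x ^ (c / 2) * x ^ (1 - c / 2) := mul_lt_mul_of_pos_left h1 (Real.rpow_pos_of_pos hx0 _)
    _ = x := by
        rw [← Real.rpow_add hx0, show c / 2 + (1 - c / 2) = 1 by ring, Real.rpow_one]

/-- The growth estimate behind "this upper bound is smaller than the actual number of edges of
`Newt(f_n)`, namely, `2ⁿ` (here, we use the fact that the constant `c` … is smaller than 2)":
for `0 ≤ c < 2` and constants `L, K ≥ 0`, eventually in `n`,
`(L + K·(⌊√(2n+3)⌋ + 1)·log₂(n+2))^c < n`. [cite: KoiranPortierTavenasThomasse2015, §3 (proof of Thm. 1, p0005:L13–L16)] -/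
private theorem eventually_base_rpow_lt {c : ℝ} (hc0 : 0 ≤ c) (hc : c < 2) {L K : ℝ} (hL : 0 ≤ L)
    (hK : 0 ≤ K) :
    ∀ᶠ n : ℕ in atTop,
      (L + K * ((Nat.sqrt (2 * n + 3) : ℝ) + 1) * Real.logb 2 ((n : ℝ) + 2)) ^ c < (n : ℝ) := by
  have hlog2 : 0 < Real.log 2 := Real.log_pos one_lt_two
  set D : ℝ := L + 6 * K / Real.log 2 with hD
  have hD0 : 0 ≤ D := by positivity
  have hreal := eventually_mul_sqrt_mul_log_rpow_lt hc hD0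
  filter_upwards [tendsto_natCast_atTop_atTop.eventually hreal, eventually_ge_atTop 3] with n hn hn3
  have hn3' : (3 : ℝ) ≤ n := by exact_mod_cast hn3
  have hn0 : (0 : ℝ) < n := by linarith
  -- `1 ≤ log n`, `1 ≤ √n`
  have hlogn : 1 ≤ Real.log n := by
    rw [Real.le_log_iff_exp_le hn0]
    exact (Real.exp_one_lt_three.le).trans hn3'
  have hsqrt1 : 1 ≤ Real.sqrt n := Real.le_sqrt_of_sq_le (by linarith)
  -- `⌊√(2n+3)⌋ + 1 ≤ 3 √n`
  have hs : ((Nat.sqrt (2 * n + 3) : ℕ) : ℝ) + 1 ≤ 3 * Real.sqrt n := by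
    have h1 : ((Nat.sqrt (2 * n + 3) : ℕ) : ℝ) ≤ Real.sqrt ((2 * n + 3 : ℕ) : ℝ) :=
      Real.nat_sqrt_le_real_sqrt
    have h2 : Real.sqrt ((2 * n + 3 : ℕ) : ℝ) ≤ 2 * Real.sqrt n := by
      rw [Real.sqrt_le_left (by positivity), mul_pow, Real.sq_sqrt hn0.le]
      push_cast
      linarith
    linarith
  -- `log₂ (n+2) ≤ 2 log n / log 2`
  have hl : Real.logb 2 ((n : ℝ) + 2) ≤ 2 * Real.log n / Real.log 2 := by
    rw [← Real.log_div_log]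
    refine div_le_div_of_nonneg_right ?_ hlog2.le
    calc Real.log ((n : ℝ) + 2) ≤ Real.log ((n : ℝ) ^ 2) :=
          Real.log_le_log (by linarith) (by nlinarith)
      _ = 2 * Real.log n := by rw [Real.log_pow]; norm_num
  have hl0 : 0 ≤ Real.logb 2 ((n : ℝ) + 2) := Real.logb_nonneg one_lt_two (by linarith)
  -- the base is at most `D √n log n`
  have hbase : L + K * (((Nat.sqrt (2 * n + 3) : ℕ) : ℝ) + 1) * Real.logb 2 ((n : ℝ) + 2) ≤
      D * Real.sqrt n * Real.log n := by
    have h1 : L ≤ L * (Real.sqrt n * Real.log n) :=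
      le_mul_of_one_le_right hL (one_le_mul_of_one_le_of_one_le hsqrt1 hlogn)
    have h2 : K * (((Nat.sqrt (2 * n + 3) : ℕ) : ℝ) + 1) * Real.logb 2 ((n : ℝ) + 2) ≤
        K * (3 * Real.sqrt n) * (2 * Real.log n / Real.log 2) := by
      gcongr
    calc L + K * (((Nat.sqrt (2 * n + 3) : ℕ) : ℝ) + 1) * Real.logb 2 ((n : ℝ) + 2)
        ≤ L * (Real.sqrt n * Real.log n) + K * (3 * Real.sqrt n) * (2 * Real.log n / Real.log 2) :=
          add_le_add h1 h2
      _ = D * Real.sqrt n * Real.log n := by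
          rw [hD]
          field_simp
          ring
  have hbase0 : 0 ≤ L + K * (((Nat.sqrt (2 * n + 3) : ℕ) : ℝ) + 1) * Real.logb 2 ((n : ℝ) + 2) := by
    positivity
  exact (Real.rpow_le_rpow hbase0 hbase hc0).trans_lt hn

/-! ### Padding a sum of products with zero products ("`kmt` sufficiently large") -/

/-- Support of `C c * g` is contained in the support of `g`. [folklore] -/
private theorem card_support_C_mul_le_right {σ : Type*} (c : ℂ) (g : MvPolynomial σ ℂ) :
    (C c * g).support.card ≤ g.support.card := by
  classical
  refine Finset.card_le_card fun x hx => ?_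
  rw [MvPolynomial.mem_support_iff] at hx ⊢
  rw [MvPolynomial.coeff_C_mul] at hx
  exact fun h0 => hx (by rw [h0, mul_zero])

/-! ### The core: Theorem 1's proof for the bound `2^{(A(m + log₂ kt))^c}` -/

/-- **The proof of KPTT Theorem 1, for the refined bound with a constant factor inside the power.**
IF, for some real `c < 2`, some `A ≥ 1` and some `N₀`, every `f = Σ_{i<k} Π_{j<m} f_ij` over `ℂ`
with `t`-sparse bivariate `f_ij`, `k, m, t ≥ 1` and `kmt ≥ N₀` has a Newton polygon with at most
`2^{(A·(m + log₂ kt))^c}` vertices (an OPEN hypothesis for `A = 1`; nothing here asserts it), THEN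
the permanent family is not in `VP_ℂ`. Printed proof of Theorem 1 (§3): under `PER ∈ VP_ℂ` the
witness `F_n` (`2ⁿ` vertices) is `Σ_{i≤k} Π_{j≤m} g_ij` with `k, t = n^{O(√n log n)}`, `m = O(√n)`
(tree: `exists_sps_xy_of_isProjection_perPoly`), so `A(m + log₂ kt) = O(√n log n)` and
`2ⁿ ≤ 2^{O(√n log n)^c}` fails for large `n` as `c < 2` (`eventually_base_rpow_lt`); the
representation is padded with `N₀` zero products to make `kmt` large. The factor `A` is what
Theorem 3's reduction costs (`not_isVPFamily_per_of_refinedPowersBound`). [cite: KoiranPortierTavenasThomasse2015, Thm. 1 and its proof (§3, p0005:L1–L82)] -/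
theorem not_isVPFamily_per_of_refinedBound_mul (c : ℝ) (hc : c < 2) (A : ℝ) (hA : 1 ≤ A) (N₀ : ℕ)
    (hbound : ∀ (k m t : ℕ) (f : Fin k → Fin m → MvPolynomial (Fin 2) ℂ),
      N₀ ≤ k * m * t → 1 ≤ k → 1 ≤ m → 1 ≤ t → (∀ i j, (f i j).support.card ≤ t) →
        (newtonVertexCount (∑ i, ∏ j, f i j) : ℝ) ≤
          (2 : ℝ) ^ ((A * ((m : ℝ) + Real.logb 2 ((k : ℝ) * t))) ^ c)) :
    ¬ IsVPFamily (fun n => perPoly (Fin n) ℂ) := by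
  intro hVP
  classical
  -- the exponent may be taken in `[1, 2)` (the hypothesis is only used with base `≥ 1`)
  set c' : ℝ := max c 1 with hc'def
  have hc'2 : c' < 2 := max_lt hc one_lt_two
  have hc'1 : 1 ≤ c' := le_max_right _ _
  have hc'0 : 0 ≤ c' := zero_le_one.trans hc'1
  have hcc' : c ≤ c' := le_max_left _ _
  have hA0 : 0 ≤ A := zero_le_one.trans hA
  -- Step 2 (printed): `h_n` is a projection of `PER_{q(n)}`, `q` p-bounded
  obtain ⟨q, hq, hproj⟩ := exists_isProjection_hV_perPoly_complex
  have hτ : IsPBounded fun n => complexity (perPoly (Fin n) ℂ) := hVP.2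
  -- Step 3 (printed): the sum-of-products-of-sparse form of `F_n`
  have hdP : IsPBounded (fun n => 2 * n + 3) :=
    (IsPBounded.iff_exists_le_mul_succ_pow _).2 ⟨3, 1, fun n => by rw [pow_one]; omega⟩
  obtain ⟨C, hC⟩ := exists_sps_xy_of_isProjection_perPoly hτ (fun n => 2 * n + 3)
    (fun n => 2 * n + 3) hdP (fun n => le_rfl) q hq (fun n => hV ℂ n) hproj
    (fun n => hV_multilinear n)
  -- Step 4: a bad `n` (this is where `c < 2` is used)
  set L : ℝ := Real.logb 2 ((N₀ : ℝ) + 1) with hLdef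
  have hL0 : 0 ≤ L := Real.logb_nonneg one_lt_two (by
    have := (Nat.cast_nonneg N₀ : (0 : ℝ) ≤ N₀); linarith)
  have hAL0 : 0 ≤ A * L := mul_nonneg hA0 hL0
  have hK0 : 0 ≤ 3 * A * (C : ℝ) := by positivity
  obtain ⟨n, hnlt, hn1⟩ :=
    ((eventually_base_rpow_lt hc'0 hc'2 hAL0 hK0).and (eventually_ge_atTop 1)).exists
  obtain ⟨k, m, t, g, hk, hm, ht, hg, hsum⟩ := hC n
  rw [aeval_xySubst_hV n] at hsum
  -- `F_n` has `2ⁿ ≥ 2` monomials, so `k, m, t ≥ 1`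
  have hcard : (kpttPoly n).support.card = 2 ^ n := card_support_kpttPoly n
  have h2n : 2 ≤ 2 ^ n := by
    calc 2 = 2 ^ 1 := (pow_one 2).symm
      _ ≤ 2 ^ n := Nat.pow_le_pow_right (by norm_num) hn1
  have hm1 : 1 ≤ m := by
    rcases Nat.eq_zero_or_pos m with rfl | h
    · exfalso
      have hconst : kpttPoly n = MvPolynomial.C (k : ℂ) := by
        rw [← hsum]; simp
      have hle : (kpttPoly n).support.card ≤ 1 := by
        rw [hconst, MvPolynomial.C_apply]
        exact (Finset.card_le_card MvPolynomial.support_monomial_subset).trans (by simp)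
      omega
    · exact h
  have ht1 : 1 ≤ t := by
    rcases Nat.eq_zero_or_pos t with rfl | h
    · exfalso
      have h0 : ∀ i j, g i j = 0 := fun i j => by
        have := hg i j
        rwa [Nat.le_zero, Finset.card_eq_zero, MvPolynomial.support_eq_empty] at this
      have hzero : kpttPoly n = 0 := by
        rw [← hsum]
        refine Finset.sum_eq_zero fun i _ => ?_
        exact Finset.prod_eq_zero (Finset.mem_univ (⟨0, hm1⟩ : Fin m)) (h0 i _)
      rw [hzero, MvPolynomial.support_zero, Finset.card_empty] at hcard
      omega
    · exact h
  have hk1 : 1 ≤ k := by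
    rcases Nat.eq_zero_or_pos k with rfl | h
    · exfalso
      have hzero : kpttPoly n = 0 := by rw [← hsum]; simp
      rw [hzero, MvPolynomial.support_zero, Finset.card_empty] at hcard
      omega
    · exact h
  -- pad with `N₀` zero products, so that `kmt` is large
  let g' : Fin (k + N₀) → Fin m → MvPolynomial (Fin 2) ℂ := Fin.append g (fun _ _ => 0)
  have hg' : ∀ i j, (g' i j).support.card ≤ t := by
    intro i j
    induction i using Fin.addCases with
    | left i => simp only [g', Fin.append_left]; exact hg i j
    | right i => simp [g']
  have hsum' : ∑ i, ∏ j, g' i j = kpttPoly n := by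
    rw [Fin.sum_trunc]
    · simp only [g', Fin.append_left]; exact hsum
    · intro i
      simp only [g', Fin.append_right]
      exact Finset.prod_eq_zero (Finset.mem_univ (⟨0, hm1⟩ : Fin m)) rfl
  have hN : N₀ ≤ (k + N₀) * m * t := by
    calc N₀ = N₀ * 1 * 1 := by ring
      _ ≤ (k + N₀) * m * t :=
          Nat.mul_le_mul (Nat.mul_le_mul (Nat.le_add_left N₀ k) hm1) ht1
  have hcount := hbound (k + N₀) m t g' hN (by omega) hm1 ht1 hg'
  rw [hsum', newtonVertexCount_kpttPoly] at hcount
  push_cast at hcount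
  -- the base `x = A (m + log₂ ((k + N₀) t))` and `n ≤ x ^ c`
  have hm1' : (1 : ℝ) ≤ m := by exact_mod_cast hm1
  have hkt1 : (1 : ℝ) ≤ ((k : ℝ) + N₀) * t := by
    have h1 : (1 : ℝ) ≤ (k : ℝ) + N₀ := by
      have hk' : (1 : ℝ) ≤ k := by exact_mod_cast hk1
      have hN' : (0 : ℝ) ≤ N₀ := Nat.cast_nonneg N₀
      linarith
    have h2 : (1 : ℝ) ≤ t := by exact_mod_cast ht1
    nlinarith
  have hlog0 : 0 ≤ Real.logb 2 (((k : ℝ) + N₀) * t) := Real.logb_nonneg one_lt_two hkt1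
  have hx1 : 1 ≤ A * ((m : ℝ) + Real.logb 2 (((k : ℝ) + N₀) * t)) := by nlinarith
  have hx0 : 0 ≤ A * ((m : ℝ) + Real.logb 2 (((k : ℝ) + N₀) * t)) := zero_le_one.trans hx1
  have hnle : (n : ℝ) ≤ (A * ((m : ℝ) + Real.logb 2 (((k : ℝ) + N₀) * t))) ^ c := by
    rw [← Real.rpow_natCast] at hcount
    exact (Real.rpow_le_rpow_left_iff one_lt_two).1 hcount
  -- bound the base: `m ≤ E`, `(k + N₀) t ≤ (N₀ + 1) (n+2)^{2E}`, `E = C (⌊√(2n+3)⌋ + 1)`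
  set E : ℕ := C * (Nat.sqrt (2 * n + 3) + 1) with hE
  have h1E : 1 ≤ (n + 2) ^ E := Nat.one_le_pow _ _ (by omega)
  have hktN : (k + N₀) * t ≤ (N₀ + 1) * (n + 2) ^ (2 * E) := by
    have hkN : k + N₀ ≤ (N₀ + 1) * (n + 2) ^ E := by nlinarith [hk, h1E]
    calc (k + N₀) * t ≤ ((N₀ + 1) * (n + 2) ^ E) * (n + 2) ^ E := Nat.mul_le_mul hkN ht
      _ = (N₀ + 1) * (n + 2) ^ (2 * E) := by rw [mul_assoc, ← pow_add, two_mul]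
  have hℓ1 : 1 ≤ Real.logb 2 ((n : ℝ) + 2) := by
    rw [← Real.logb_self_eq_one one_lt_two]
    exact Real.logb_le_logb_of_le one_lt_two two_pos (by linarith [(Nat.cast_nonneg n : (0:ℝ) ≤ n)])
  have hlogle : Real.logb 2 (((k : ℝ) + N₀) * t) ≤ L + 2 * (E : ℝ) * Real.logb 2 ((n : ℝ) + 2) := by
    have hpos : (0 : ℝ) < ((k : ℝ) + N₀) * t := by linarith
    have hle : ((k : ℝ) + N₀) * t ≤ ((N₀ : ℝ) + 1) * ((n : ℝ) + 2) ^ (2 * E) := by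
      exact_mod_cast hktN
    calc Real.logb 2 (((k : ℝ) + N₀) * t)
        ≤ Real.logb 2 (((N₀ : ℝ) + 1) * ((n : ℝ) + 2) ^ (2 * E)) :=
          Real.logb_le_logb_of_le one_lt_two hpos hle
      _ = L + ((2 * E : ℕ) : ℝ) * Real.logb 2 ((n : ℝ) + 2) := by
          rw [Real.logb_mul (by positivity) (by positivity), Real.logb_pow]
      _ = L + 2 * (E : ℝ) * Real.logb 2 ((n : ℝ) + 2) := by push_cast; ring
  have hbase : A * ((m : ℝ) + Real.logb 2 (((k : ℝ) + N₀) * t)) ≤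
      A * L + 3 * A * (C : ℝ) * (((Nat.sqrt (2 * n + 3) : ℕ) : ℝ) + 1) * Real.logb 2 ((n : ℝ) + 2) := by
    have hmE : (m : ℝ) ≤ E := by exact_mod_cast hm
    have hEℓ : (E : ℝ) ≤ E * Real.logb 2 ((n : ℝ) + 2) :=
      le_mul_of_one_le_right (Nat.cast_nonneg E) hℓ1
    have hEeq : (E : ℝ) = C * (((Nat.sqrt (2 * n + 3) : ℕ) : ℝ) + 1) := by
      rw [hE]; push_cast; ring
    have h3 : (m : ℝ) + Real.logb 2 (((k : ℝ) + N₀) * t) ≤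
        L + 3 * (E : ℝ) * Real.logb 2 ((n : ℝ) + 2) := by linarith
    calc A * ((m : ℝ) + Real.logb 2 (((k : ℝ) + N₀) * t))
        ≤ A * (L + 3 * (E : ℝ) * Real.logb 2 ((n : ℝ) + 2)) := mul_le_mul_of_nonneg_left h3 hA0
      _ = A * L + 3 * A * (C : ℝ) * (((Nat.sqrt (2 * n + 3) : ℕ) : ℝ) + 1) *
            Real.logb 2 ((n : ℝ) + 2) := by rw [hEeq]; ring
  -- the contradiction `n < n`
  have key : (n : ℝ) < n :=
    calc (n : ℝ) ≤ (A * ((m : ℝ) + Real.logb 2 (((k : ℝ) + N₀) * t))) ^ c := hnle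
      _ ≤ (A * ((m : ℝ) + Real.logb 2 (((k : ℝ) + N₀) * t))) ^ c' :=
          Real.rpow_le_rpow_of_exponent_le hx1 hcc'
      _ ≤ (A * L + 3 * A * (C : ℝ) * (((Nat.sqrt (2 * n + 3) : ℕ) : ℝ) + 1) *
            Real.logb 2 ((n : ℝ) + 2)) ^ c' := Real.rpow_le_rpow hx0 hbase hc'0
      _ < n := hnlt
  exact lt_irrefl _ key

/-! ### Theorem 1 as printed -/

/-- **KPTT 2015, Theorem 1 (as printed).** "Assume that for some universal constant `c < 2`, the
upper bound `2^{(m + log kt)^c}` on the number of edges of `Newt(f)` holds true for polynomials of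
the form (1) [`f = Σ_{i=1}^k Π_{j=1}^m f_ij`, `f_ij` with at most `t` monomials] whenever the product
`kmt` is sufficiently large. Then the permanent is not computable by polynomial size arithmetic
circuits." Over `ℂ` (print: characteristic `0`; Remark 1: `≠ 2`), with `log = log₂`, edges as
`newtonVertexCount`, "sufficiently large" as `N₀ ≤ kmt`, and the conclusion `¬ IsVPFamily (per_n)`
as in the tree's weak-form instance `KPTT.theorem1`. The hypothesis is an explicit binder and is
OPEN (it is implied by the conjectural `newtonTauWeak`, `refinedBound_of_newtonTauWeak`); KPTT's
refined bound is not asserted anywhere in the tree; `VP ≠ VNP` is NOT proved. Proof: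
`not_isVPFamily_per_of_refinedBound_mul` with `A = 1`.
[cite: KoiranPortierTavenasThomasse2015, Thm. 1 (§2, held text p0004:L103–L109; proof §3)] -/
theorem not_isVPFamily_per_of_refinedBound (c : ℝ) (hc : c < 2) (N₀ : ℕ)
    (hbound : ∀ (k m t : ℕ) (f : Fin k → Fin m → MvPolynomial (Fin 2) ℂ),
      N₀ ≤ k * m * t → (∀ i j, (f i j).support.card ≤ t) →
        (newtonVertexCount (∑ i, ∏ j, f i j) : ℝ) ≤
          (2 : ℝ) ^ (((m : ℝ) + Real.logb 2 ((k : ℝ) * t)) ^ c)) :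
    ¬ IsVPFamily (fun n => perPoly (Fin n) ℂ) :=
  not_isVPFamily_per_of_refinedBound_mul c hc 1 le_rfl N₀ fun k m t f hN _ _ _ hf => by
    rw [one_mul]; exact hbound k m t f hN hf

/-! ### "For instance, an upper bound of the form `2^{O(m)}(kt)^{O(1)}` would be sufficient" -/

/-- `log₂ m ≤ m` for a natural number `m ≥ 1`. [folklore] -/
private theorem logb_two_natCast_le (m : ℕ) (hm : 1 ≤ m) : Real.logb 2 (m : ℝ) ≤ m := by
  have hm0 : (0 : ℝ) < m := by exact_mod_cast hm
  rw [Real.logb_le_iff_le_rpow one_lt_two hm0, Real.rpow_natCast]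
  exact_mod_cast (Nat.lt_two_pow_self).le

/-- **The sentence after Theorem 1 made formal** ("For instance, an upper bound of the form
`2^{O(m)}(kt)^{O(1)}` would be sufficient"): the weak-form bound `newtonTauWeak`
(`#vert ≤ 2^{am}(kt+2)^b`) is the STRONGER hypothesis — it implies the printed hypothesis of
Theorem 1 with `c = 3/2`, for `kmt` sufficiently large (`N₀ = 2^{(a+3b)²}`: then
`x = m + log₂ kt ≥ (a+3b)²`, and `am + b·log₂(kt+2) ≤ (a+3b)·x ≤ x^{3/2}`). Hence the tree's
weak-form instance `KPTT.theorem1` (`theorem1_holds`) follows from `not_isVPFamily_per_of_refinedBound`.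
Both bounds are OPEN; the implication asserts neither.
[cite: KoiranPortierTavenasThomasse2015, sentence after Thm. 1 (§2, held text p0004:L111–L112)] -/
theorem refinedBound_of_newtonTauWeak (h : newtonTauWeak) :
    ∃ N₀ : ℕ, ∀ (k m t : ℕ) (f : Fin k → Fin m → MvPolynomial (Fin 2) ℂ),
      N₀ ≤ k * m * t → (∀ i j, (f i j).support.card ≤ t) →
        (newtonVertexCount (∑ i, ∏ j, f i j) : ℝ) ≤
          (2 : ℝ) ^ (((m : ℝ) + Real.logb 2 ((k : ℝ) * t)) ^ (3 / 2 : ℝ)) := by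
  obtain ⟨a, b, hab⟩ := h
  refine ⟨2 ^ ((a + 3 * b) ^ 2), fun k m t f hN hf => ?_⟩
  -- `k, m, t ≥ 1`
  have hN1 : 1 ≤ k * m * t := le_trans (Nat.one_le_two_pow) hN
  have hk1 : 1 ≤ k := by
    rcases Nat.eq_zero_or_pos k with rfl | h
    · simp at hN1
    · exact h
  have hm1 : 1 ≤ m := by
    rcases Nat.eq_zero_or_pos m with rfl | h
    · simp at hN1
    · exact h
  have ht1 : 1 ≤ t := by
    rcases Nat.eq_zero_or_pos t with rfl | h
    · simp at hN1
    · exact h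
  have hcount : (newtonVertexCount (∑ i, ∏ j, f i j) : ℝ) ≤ (2 : ℝ) ^ (a * m) * ((k : ℝ) * t + 2) ^ b := by
    exact_mod_cast hab k m t f hf
  -- real bookkeeping
  set B : ℕ := a + 3 * b with hBdef
  set x : ℝ := (m : ℝ) + Real.logb 2 ((k : ℝ) * t) with hxdef
  have hm' : (1 : ℝ) ≤ m := by exact_mod_cast hm1
  have hk' : (1 : ℝ) ≤ k := by exact_mod_cast hk1
  have ht' : (1 : ℝ) ≤ t := by exact_mod_cast ht1
  have hkt1 : (1 : ℝ) ≤ (k : ℝ) * t := by nlinarith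
  have hkt0 : (0 : ℝ) < (k : ℝ) * t := by linarith
  have hlog0 : 0 ≤ Real.logb 2 ((k : ℝ) * t) := Real.logb_nonneg one_lt_two hkt1
  have hx1 : 1 ≤ x := by rw [hxdef]; linarith
  have hx0 : 0 < x := by linarith
  -- `x ≥ log₂ (kmt) ≥ B²`
  have hxB : ((B : ℝ)) ^ 2 ≤ x := by
    have h1 : Real.logb 2 ((k : ℝ) * m * t) ≤ x := by
      have hsplit : Real.logb 2 ((k : ℝ) * m * t) = Real.logb 2 ((k : ℝ) * t) + Real.logb 2 (m : ℝ) := by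
        rw [show (k : ℝ) * m * t = ((k : ℝ) * t) * m by ring,
          Real.logb_mul (by positivity) (by positivity)]
      rw [hsplit, hxdef]
      linarith [logb_two_natCast_le m hm1]
    have h2 : ((B : ℝ)) ^ 2 ≤ Real.logb 2 ((k : ℝ) * m * t) := by
      have hNr : ((2 : ℝ)) ^ ((B ^ 2 : ℕ) : ℝ) ≤ (k : ℝ) * m * t := by
        rw [Real.rpow_natCast]; exact_mod_cast hN
      have := (Real.le_logb_iff_rpow_le one_lt_two (by positivity)).2 hNr
      push_cast at this
      exact this
    exact h2.trans h1
  -- `B x ≤ x^{3/2}`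
  have hBx : (B : ℝ) * x ≤ x ^ (3 / 2 : ℝ) := by
    have hB0 : (0 : ℝ) ≤ B := Nat.cast_nonneg B
    have hBle : (B : ℝ) ≤ Real.sqrt x := Real.le_sqrt_of_sq_le hxB
    calc (B : ℝ) * x ≤ Real.sqrt x * x := mul_le_mul_of_nonneg_right hBle hx0.le
      _ = x ^ (3 / 2 : ℝ) := by
          rw [Real.sqrt_eq_rpow, ← Real.rpow_add_one hx0.ne']
          norm_num
  -- `2^{am} (kt+2)^b = 2^{am + b log₂(kt+2)}` and `am + b log₂ (kt+2) ≤ B x`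
  have hkt2 : Real.logb 2 ((k : ℝ) * t + 2) ≤ Real.logb 2 ((k : ℝ) * t) + 2 := by
    have h4 : (k : ℝ) * t + 2 ≤ 4 * ((k : ℝ) * t) := by linarith
    calc Real.logb 2 ((k : ℝ) * t + 2) ≤ Real.logb 2 (4 * ((k : ℝ) * t)) :=
          Real.logb_le_logb_of_le one_lt_two (by linarith) h4
      _ = Real.logb 2 4 + Real.logb 2 ((k : ℝ) * t) := Real.logb_mul (by norm_num) hkt0.ne'
      _ = Real.logb 2 ((k : ℝ) * t) + 2 := by
          rw [show (4 : ℝ) = 2 ^ (2 : ℕ) by norm_num, Real.logb_pow,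
            Real.logb_self_eq_one one_lt_two]
          ring
  have hexp : (a : ℝ) * m + b * Real.logb 2 ((k : ℝ) * t + 2) ≤ (B : ℝ) * x := by
    have ha0 : (0 : ℝ) ≤ a := Nat.cast_nonneg a
    have hb0 : (0 : ℝ) ≤ b := Nat.cast_nonneg b
    have h1 : (b : ℝ) * Real.logb 2 ((k : ℝ) * t + 2) ≤ b * (Real.logb 2 ((k : ℝ) * t) + 2) :=
      mul_le_mul_of_nonneg_left hkt2 hb0
    have hB : (B : ℝ) = a + 3 * b := by rw [hBdef]; push_cast; ring
    rw [hB, hxdef]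
    nlinarith
  have hpow : (2 : ℝ) ^ (a * m) * ((k : ℝ) * t + 2) ^ b =
      (2 : ℝ) ^ ((a : ℝ) * m + b * Real.logb 2 ((k : ℝ) * t + 2)) := by
    have hkt2pos : (0 : ℝ) < (k : ℝ) * t + 2 := by linarith
    have h1 : (2 : ℝ) ^ (a * m) = (2 : ℝ) ^ ((a : ℝ) * m) := by
      rw [← Nat.cast_mul, Real.rpow_natCast]
    have h2 : ((k : ℝ) * t + 2) ^ b = (2 : ℝ) ^ ((b : ℝ) * Real.logb 2 ((k : ℝ) * t + 2)) := by
      rw [mul_comm (b : ℝ), Real.rpow_mul (by norm_num : (0 : ℝ) ≤ 2),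
        Real.rpow_logb two_pos (by norm_num) hkt2pos, Real.rpow_natCast]
    rw [h1, h2, ← Real.rpow_add two_pos]
  calc (newtonVertexCount (∑ i, ∏ j, f i j) : ℝ) ≤ (2 : ℝ) ^ (a * m) * ((k : ℝ) * t + 2) ^ b := hcount
    _ = (2 : ℝ) ^ ((a : ℝ) * m + b * Real.logb 2 ((k : ℝ) * t + 2)) := hpow
    _ ≤ (2 : ℝ) ^ ((B : ℝ) * x) := Real.rpow_le_rpow_of_exponent_le one_le_two hexp
    _ ≤ (2 : ℝ) ^ (x ^ (3 / 2 : ℝ)) := Real.rpow_le_rpow_of_exponent_le one_le_two hBx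

-- The weak-form instance `KPTT.theorem1` is thus a corollary of the printed theorem:
-- `fun hW => (refinedBound_of_newtonTauWeak hW).elim fun N₀ h => not_isVPFamily_per_of_refinedBound (3/2) (by norm_num) N₀ h`
-- proves `theorem1` (not restated here: it is the landed `KPTT.theorem1_holds`).

/-! ### Theorem 3 as printed -/

/-- The number of `(i, S)` pairs: `|Fin k × Finset (Fin m)| = k · 2^m`. [folklore] -/
private theorem card_prod_finset' (k m : ℕ) : Fintype.card (Fin k × Finset (Fin m)) = k * 2 ^ m := by
  rw [Fintype.card_prod, Fintype.card_fin, Fintype.card_finset, Fintype.card_fin]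

/-- **KPTT 2015, Theorem 3 (as printed): it suffices to bound the Newton polygons of sums of
powers.** "Fix a universal constant `c < 2`, and assume that we have the upper bound
`2^{(m + log kt)^c}` on the number of edges of `Newt(f)` for polynomials of the form
`f(X,Y) = Σ_{i=1}^k a_i f_i(X,Y)^m` where `a_i ∈ 𝕂` and the `f_i` have at most `t` monomials (as in
Theorem 1, we require this upper bound to hold only if `kmt` is sufficiently large). Then the
permanent is not computable by polynomial size arithmetic circuits." Over `ℂ`, conventions as in
`not_isVPFamily_per_of_refinedBound` (the hypothesis is an explicit OPEN binder, never asserted;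
`VP ≠ VNP` is NOT proved). Printed proof:
Fischer's formula (Lemma 1) rewrites form (1) with parameters `(k, m, t)` as a sum of `2^{m-1}k`
(tree: `k·2^m`, `KPTT.sum_prod_eq_sum_powers`) `m`-th powers of `mt`-sparse polynomials, "so the
assumption in Theorem 3 implies that of Theorem 1" — precisely: it implies the Theorem-1-type bound
`2^{(3(m + log₂ kt))^{max c 0}}` (as `m + log₂(k2^m·mt) ≤ 3(m + log₂ kt)`), and the proof of
Theorem 1 absorbs the factor `3` (`not_isVPFamily_per_of_refinedBound_mul`).
[cite: KoiranPortierTavenasThomasse2015, Thm. 3 and its proof (§3, held text p0005:L92–L102, p0005:L126–p0006:L8)] -/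
theorem not_isVPFamily_per_of_refinedPowersBound (c : ℝ) (hc : c < 2) (N₀ : ℕ)
    (hbound : ∀ (k m t : ℕ) (a : Fin k → ℂ) (g : Fin k → MvPolynomial (Fin 2) ℂ),
      N₀ ≤ k * m * t → (∀ i, (g i).support.card ≤ t) →
        (newtonVertexCount (∑ i, C (a i) * g i ^ m) : ℝ) ≤
          (2 : ℝ) ^ (((m : ℝ) + Real.logb 2 ((k : ℝ) * t)) ^ c)) :
    ¬ IsVPFamily (fun n => perPoly (Fin n) ℂ) := by
  classical
  set c' : ℝ := max c 0 with hc'def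
  have hc'2 : c' < 2 := max_lt hc two_pos
  have hc'0 : 0 ≤ c' := le_max_right _ _
  have hcc' : c ≤ c' := le_max_left _ _
  refine not_isVPFamily_per_of_refinedBound_mul c' hc'2 3 (by norm_num) N₀
    fun k m t f hN hk1 hm1 ht1 hf => ?_
  -- Fischer: reindex the `(i, S)` pairs by `Fin (k * 2^m)`
  let e : Fin k × Finset (Fin m) ≃ Fin (k * 2 ^ m) :=
    Fintype.equivFinOfCardEq (card_prod_finset' k m)
  let g : Fin (k * 2 ^ m) → MvPolynomial (Fin 2) ℂ := fun l => ∑ j ∈ (e.symm l).2, f (e.symm l).1 j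
  let a : Fin (k * 2 ^ m) → ℂ := fun l => ((m.factorial : ℂ))⁻¹ * (-1) ^ (m - (e.symm l).2.card)
  have hsum : ∑ i, ∏ j, f i j = ∑ l, C (a l) * g l ^ m := by
    rw [sum_prod_eq_sum_powers k m f]
    exact (e.sum_comp (fun l => C (a l) * g l ^ m)).symm.trans (by simp [a, g]) |>.symm
  have hg : ∀ l, (g l).support.card ≤ m * t := fun l => by
    refine (card_support_finset_sum_le _ _ t fun j _ => hf _ j).trans ?_
    exact Nat.mul_le_mul_right t ((Finset.card_le_univ _).trans (Fintype.card_fin m).le)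
  -- `kmt ≤ (k 2^m) m (mt)`
  have hN' : N₀ ≤ (k * 2 ^ m) * m * (m * t) := by
    refine hN.trans ?_
    have h1 : 1 ≤ 2 ^ m := Nat.one_le_two_pow
    calc k * m * t = (k * 1) * m * (1 * t) := by ring
      _ ≤ (k * 2 ^ m) * m * (m * t) := by gcongr
  have hcount := hbound (k * 2 ^ m) m (m * t) a g hN' hg
  rw [← hsum] at hcount
  push_cast at hcount
  -- compare the bases: `m + log₂ (k 2^m · m t) ≤ 3 (m + log₂ kt)`
  have hm' : (1 : ℝ) ≤ m := by exact_mod_cast hm1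
  have hk' : (1 : ℝ) ≤ k := by exact_mod_cast hk1
  have ht' : (1 : ℝ) ≤ t := by exact_mod_cast ht1
  have hkt1 : (1 : ℝ) ≤ (k : ℝ) * t := by nlinarith
  have hkt0 : (0 : ℝ) < (k : ℝ) * t := by linarith
  have hm0 : (0 : ℝ) < m := by linarith
  have hlog0 : 0 ≤ Real.logb 2 ((k : ℝ) * t) := Real.logb_nonneg one_lt_two hkt1
  have hy1 : 1 ≤ (m : ℝ) + Real.logb 2 ((k : ℝ) * 2 ^ m * ((m : ℝ) * t)) := by
    have h2m : (1 : ℝ) ≤ 2 ^ m := one_le_pow₀ (by norm_num)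
    have : 0 ≤ Real.logb 2 ((k : ℝ) * 2 ^ m * ((m : ℝ) * t)) :=
      Real.logb_nonneg one_lt_two
        (one_le_mul_of_one_le_of_one_le (one_le_mul_of_one_le_of_one_le hk' h2m)
          (one_le_mul_of_one_le_of_one_le hm' ht'))
    linarith
  have hcmp : (m : ℝ) + Real.logb 2 ((k : ℝ) * 2 ^ m * ((m : ℝ) * t)) ≤
      3 * ((m : ℝ) + Real.logb 2 ((k : ℝ) * t)) := by
    have hsplit : Real.logb 2 ((k : ℝ) * 2 ^ m * ((m : ℝ) * t)) =
        Real.logb 2 ((k : ℝ) * t) + m + Real.logb 2 (m : ℝ) := by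
      rw [show (k : ℝ) * 2 ^ m * ((m : ℝ) * t) = ((k : ℝ) * t) * 2 ^ m * m by ring,
        Real.logb_mul (by positivity) (by positivity), Real.logb_mul (by positivity) (by positivity),
        Real.logb_pow, Real.logb_self_eq_one one_lt_two]
      ring
    rw [hsplit]
    linarith [logb_two_natCast_le m hm1]
  have hy0 : 0 ≤ (m : ℝ) + Real.logb 2 ((k : ℝ) * 2 ^ m * ((m : ℝ) * t)) := zero_le_one.trans hy1
  calc (newtonVertexCount (∑ i, ∏ j, f i j) : ℝ)
      ≤ (2 : ℝ) ^ (((m : ℝ) + Real.logb 2 ((k : ℝ) * 2 ^ m * ((m : ℝ) * t))) ^ c) := hcount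
    _ ≤ (2 : ℝ) ^ (((m : ℝ) + Real.logb 2 ((k : ℝ) * 2 ^ m * ((m : ℝ) * t))) ^ c') :=
        Real.rpow_le_rpow_of_exponent_le one_le_two (Real.rpow_le_rpow_of_exponent_le hy1 hcc')
    _ ≤ (2 : ℝ) ^ ((3 * ((m : ℝ) + Real.logb 2 ((k : ℝ) * t))) ^ c') :=
        Real.rpow_le_rpow_of_exponent_le one_le_two (Real.rpow_le_rpow hy0 hcmp hc'0)

/-- **KPTT 2015, Theorem 3 with the coefficient-free hypothesis** ("Clearly, we can assume that all
the coefficients `a_i` are equal to 1 (multiply `f_i` by a `m`-th root of `a_i` if necessary)"): IF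
for some `c < 2` and `N₀` every `Σ_{i<k} g_i^m` with `t`-sparse bivariate `g_i` over `ℂ` and
`kmt ≥ N₀` has at most `2^{(m + log₂ kt)^c}` vertices (OPEN hypothesis; nothing here asserts it;
`VP ≠ VNP` is NOT proved),
then `(per_n)` is not in `VP_ℂ`. Reduction as printed: over `ℂ`, `a_i g_i^m = (r_i g_i)^m` with
`r_i^m = a_i` (`m ≥ 1`; for `m = 0` the sum is a constant with at most one vertex).
[cite: KoiranPortierTavenasThomasse2015, Thm. 3 and the sentence after it (§3, held text p0005:L92–L106)] -/
theorem not_isVPFamily_per_of_refinedPurePowersBound (c : ℝ) (hc : c < 2) (N₀ : ℕ)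
    (hbound : ∀ (k m t : ℕ) (g : Fin k → MvPolynomial (Fin 2) ℂ),
      N₀ ≤ k * m * t → (∀ i, (g i).support.card ≤ t) →
        (newtonVertexCount (∑ i, g i ^ m) : ℝ) ≤
          (2 : ℝ) ^ (((m : ℝ) + Real.logb 2 ((k : ℝ) * t)) ^ c)) :
    ¬ IsVPFamily (fun n => perPoly (Fin n) ℂ) := by
  classical
  refine not_isVPFamily_per_of_refinedPowersBound c hc N₀ fun k m t a g hN hg => ?_
  rcases Nat.eq_zero_or_pos m with rfl | hm
  · -- `m = 0`: the sum is a constant, at most one vertex; the bound is `≥ 1`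
    have hconst : ∑ i, C (a i) * g i ^ 0 = C (∑ i, a i) := by simp [map_sum]
    rw [hconst]
    have h1 : (newtonVertexCount (C (∑ i, a i) : MvPolynomial (Fin 2) ℂ) : ℝ) ≤ 1 := by
      have : newtonVertexCount (C (∑ i, a i) : MvPolynomial (Fin 2) ℂ) ≤ 1 :=
        calc newtonVertexCount (C (∑ i, a i)) ≤ (C (∑ i, a i) : MvPolynomial (Fin 2) ℂ).support.card :=
              newtonVertexCount_le_card_support _
          _ ≤ 1 := by
              rw [MvPolynomial.C_apply]
              exact (Finset.card_le_card MvPolynomial.support_monomial_subset).trans (by simp)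
      exact_mod_cast this
    refine h1.trans (Real.one_le_rpow one_le_two (Real.rpow_nonneg ?_ c))
    have hlog : 0 ≤ Real.logb 2 ((k : ℝ) * t) := by
      rcases Nat.eq_zero_or_pos (k * t) with h0 | hpos
      · have : (k : ℝ) * t = 0 := by exact_mod_cast h0
        rw [this, Real.logb_zero]
      · exact Real.logb_nonneg one_lt_two (by exact_mod_cast hpos)
    push_cast
    linarith
  · -- `m ≥ 1`: absorb `a_i = r_i^m` into `g_i`
    have hr : ∀ i, ∃ r : ℂ, r ^ m = a i := fun i => IsAlgClosed.exists_pow_nat_eq (a i) hm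
    choose r hr using hr
    have heq : ∑ i, C (a i) * g i ^ m = ∑ i, (C (r i) * g i) ^ m := by
      refine Finset.sum_congr rfl fun i _ => ?_
      rw [mul_pow, ← C_pow, hr]
    rw [heq]
    exact hbound k m t (fun i => C (r i) * g i) hN fun i =>
      (card_support_C_mul_le_right _ _).trans (hg i)

end KPTT

end Literature.Computability.AlgebraicComplexity
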